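import Literature.MathematicalPhysics.QuantumFieldTheory.Balaban1983to89.Node00.HistoryTermDatum214
import Literature.MathematicalPhysics.QuantumFieldTheory.Balaban1983to89.Node00.HistoryAdmissibleClass
import Literature.MathematicalPhysics.QuantumFieldTheory.Balaban1983to89.B13Term214

/-!
# BalabanUVNodes ∕ node N22 = NE9 — THE RELATIVE-DISC CENTRED ROAD OVER THE ADMISSIBLE CLASS, MODULE J10-D: THE LOCATED INPUTS OF ONE SLICE AS ONE RECORD — LOCAL-GROWTH EDITION
# (`SliceInputsLG`: J9-D `SliceInputs` with the Lemma-2-type letters of the unclipped pair replaced by node00-def-W1 W1-12's LOCAL GROWTH vocabulary, every older-term letter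
# guarded by W1-13's admissible class `W1.AdmHist`, plus the φ-analyticity inputs of the admissible-history edition)

Cell `pub-ymgap`, HUMAN RULING D-0062 (Track A), R134 ACCELERATION re-seat `pub-ymgap-dag-n22-c` (strategy s1), generation 8, file J10-D (DEFINITION LANE: one `structure`, no theorem, no
instance ∕ notation).  Imports W1-7 `Node00/HistoryTermDatum214`, W1-13 `Node00/HistoryAdmissibleClass` (`W1.AdmHist`, `W1.spaceOfRecord` through W1's maps) and `B13Term214` (the
(2.14) term literal for the two φ-analyticity fields).  Namespace `YMDAG.N22.W1` (this seat's consumer-side namespace; NOT a W1 object — the ONE-DECLARER rule is respected: the record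
bundles HYPOTHESES of this seat's readings).  `--kind definition --supports` K3⁷ `SpineGivenEndpointR13SepCoPH` (stmt-QuantumFields-20544).

WHY.  Lens E6∕E7 (bus 2026-08-27): J9-D's Lemma-2-type letter fields (`h220U_all`, `h220Ub_all`, `h1eU_all`, `h2eU_all`, `𝒱₁`, …) — joint (2.20) of the UNCLIPPED pair, global in the
fluctuation field — have NO inhabitant uniform on the real window under the unscaled-field law (the Wilson remainder is cubic); dag-n10-c's modules 46∕47 re-prove every window-dilated
engine the J-line consumes from print-shaped LOCAL growth letters ([II] (1.34)–(1.36), Lemma 2 (1.41)–(1.43), (2.18)–(2.20)), typed at the datum by node00-def-W1 W1-12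
`TermDatum214.LocalGrowthInputs`.  Lens T32 ∕ def-W1 (R-a) ∕ W1-13: the older-term letters are inhabitable only over [I] p. 263's ADMISSIBLE class — (1.18) on the space tables AND analytic
there — `W1.AdmHist`.  THIS FILE is J9-D re-typed accordingly (field list GENERATED from the tree's J9-D by `gen/build_sliceLG.py`: drop ∕ rename ∕ add), so that the knit J10c reads
dag-n10-c 46∕47 (through J10a∕J10b) and J7a §1∕§2, J8 off ONE record per slice, with NO Lemma-2-type letter of the unclipped pair left.

HONEST FRAMING.  A LIST OF HYPOTHESES as a type — nothing asserted, nothing of Bałaban's constructed; an inhabitant at the datum of record is NODE A's ∕ N09's ∕ N10's ∕ def-W1's business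
(W1-12b `LocalGrowthInputs.ofAnalytic` supplies the local growth block from Lemma 2's analytic inputs over the admissible class; the φ-analyticity inputs are [II] p. 15's «analytic
function of (U, J)» at the member, dag-n18-c's (T-an) lane); count-neutral; N22 NOT discharged; one finite four-torus programme at fixed ε — NOT infinite volume, NOT OS on ℝ⁴, NOT a
mass gap, NOT Clay.  A6 (standing rule №189, director-ym №193): NO in-file inhabitant of this record is given here — the witness at W1-7's degenerate datum (one label with `P(t) ≠ ∅`,
one with `P(t) = ∅`) is OWED in a sibling file `…SliceInputsLGWitness`; until it lands this record is «A6-UNCHECKED».  0 `sorry`, standard axioms.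

References (TYPES only): [II] = [Balaban1988RG2Cluster] (1.26) p. 8, (1.34)–(1.36) p. 9, (1.41)–(1.43) p. 11, (2.2)–(2.3) p. 12, (2.14)–(2.26) pp. 15–17; [I] = [Balaban1987RG1] §1 p. 263,
(2.9)–(2.13) pp. 266–268.
-/

noncomputable section

namespace YMDAG.N22.W1

open Set Metric Matrix
open scoped BigOperators
open Literature.MathematicalPhysics.QuantumFieldTheory.Balaban1983to89
open Literature.MathematicalPhysics.QuantumFieldTheory.Balaban1983to89.TreeLengthTorus (TPt TDom tsys torusTreeLen)
open Literature.MathematicalPhysics.QuantumFieldTheory.Balaban1983to89.B13Bound143 (invTau)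
open Literature.MathematicalPhysics.QuantumFieldTheory.Balaban1983to89.B9Thm37GlueTorus (tdist1)
open Literature.MathematicalPhysics.QuantumFieldTheory.Balaban1983to89.B5TorusCover (UT)
open Literature.MathematicalPhysics.QuantumFieldTheory.Balaban1983to89.Step (SFConsts)
open Literature.MathematicalPhysics.QuantumFieldTheory.Balaban1983to89.Node00.Sect2 (domSys domCount CPair spaceI domSites Setting Residual)
open Literature.MathematicalPhysics.QuantumFieldTheory.Balaban1983to89.Node00.W1
open Literature.MathematicalPhysics.QuantumFieldTheory.Balaban1983to89.B13Term214 (term214 core214 F214)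
open Literature.MathematicalPhysics.QuantumFieldTheory.Balaban1983to89.B12TreeDecay (K₀ kappa₀)

variable {c₀ : B13.Consts} {P : Params} {𝔸 : Type*} [NormedRing 𝔸] [NormedAlgebra ℂ 𝔸] [CompleteSpace 𝔸] {M k L : ℕ} [NeZero L] (𝔇 : TermDatum214 c₀ P 𝔸 M k L)
  (χu χcu : (Z : (domSys P M (k + 1)).Dom) → (t : TermLabel P M k L) → ((𝔇.𝒦 Z t).Λ → ℝ) → ℝ)
  (𝒲 : (Z : (domSys P M (k + 1)).Dom) → (t : TermLabel P M k L) → CPair P 𝔸 → TDom P.d (L * domCount P M (k + 1)) → ((𝔇.𝒦 Z t).Λ → ℝ) → ℂ)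
  (𝒪 : (Z : (domSys P M (k + 1)).Dom) → (t : TermLabel P M k L) → OlderTerms P 𝔸 M k → CPair P 𝔸 → TDom P.d (L * domCount P M (k + 1)) →
    ((𝔇.𝒦 Z t).Λ → ℝ) → ℂ)

open Classical in
/-- **THE LOCATED INPUTS OF ONE SLICE — LOCAL-GROWTH EDITION OVER THE ADMISSIBLE CLASS** — for the window-dilated member of base point `s₀` of the term `(Z, t)` of the
(2.14) datum `𝔇` at the configuration `φ` (J5's family over the unscaled-field data `χᵘ, χᶜᵘ, 𝒲, 𝒪`), with the estimate's constants `c`, the space tables `(Sg, Rz, cs)`, the (1.18)-size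
`E₀·e^{−κ_E·d}` of ADMISSIBLE histories, the weight letters `a, a₅`, the ball radius `ρb`, the vertex constant `Mv` and the slice letters `a′ w′ a_c w_c`: J9-D `SliceInputs` with (i) its
Lemma-2-type letters of the UNCLIPPED pair (joint (2.20), the member's (2.20), the exponential-moment Taylor letters, `𝒱₁`) REMOVED (lens E6∕E7: no inhabitant uniform on the window),
(ii) node00-def-W1 W1-12's LOCAL GROWTH block ADDED (slice-level letters; the older-term letters (L0) (L4) (L5) (L6), the linear part `D𝒪`, measurability and `Y`-locality asked for
EVERY ADMISSIBLE history `old ∈ W1.AdmHist (W1.spaceOfRecord Sg Rz α₀ α₁) E₀ κ_E k` — (1.18) on the tables of record AND analytic there, [I] p. 263; lens T32 ∕ (R-a)), (iii) the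
closures of the slice letters against the local growth constants, (iv) the curve law `hOhol` with the analytic guard, (v) the two φ-analyticity inputs of the ᴬ edition (member and
centre analytic in the configuration, [II] p. 15), (vi) director-ym №193 (ref-G's located vacuity of J9-D at labels with `P(t) ≠ ∅`): the BOX block (`hboxR hRb hMvT hχ1`) is asked only
on `P(t) = ∅` and the (2.22)-SURPLUS block (`hr₁ hPa1 hTP hMvP`) only on `P(t) ≠ ∅` — print: `χ·χᶜ` vanishes near `B′ = 0` for a large-field term, the box law is a small-field statement.  Consumed by the knit J10c with the readings J10a ∕ J10b (dag-n10-c modules 46∕47) and J7a §1∕§2, J8.  A list of hypotheses;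
nothing asserted. [cite: Balaban1988RG2Cluster, (1.34)-(1.36) p.9, Lemma 2 (1.41)-(1.43) p.11, (2.2)-(2.3) p.12, (2.14)-(2.26) pp.15-17, (1.26) p.8; Balaban1987RG1, §1 p.263, (2.9)-(2.13) pp.266-268] -/
structure SliceInputsLG (c : B13.Consts) {G : Type*} [GaugeGroup G] (Sg : Setting 𝔸 G) (Rz : Residual P 𝔸) (cs : SFConsts) (E₀ κE : ℝ)
    (Z : (domSys P M (k + 1)).Dom) (t : TermLabel P M k L) (φ : CPair P 𝔸) (s₀ a a₅ ρb Mv : ℝ) where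
  /-- located letter `Uσ` -/
  Uσ : Set ℂ
  /-- located letter `Uτ` -/
  Uτ : TDom P.d (L * domCount P M (k + 1)) → Set ℂ
  /-- located letter `γ₂` -/
  γ₂ : ℝ
  /-- located letter `rP` -/
  rP : ℝ
  /-- located letter `qP` -/
  qP : ((𝔇.𝒦 Z t).Λ → ℝ) → ℝ
  /-- located letter `kap` -/
  kap : ℝ
  /-- located letter `kap'` -/
  kap' : ℝ
  /-- located letter `kap''` -/
  kap'' : ℝ
  /-- located letter `θ` -/
  θ : ℝ
  /-- located letter `θE` -/
  θE : ℝ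
  /-- located letter `θΓ` -/
  θΓ : ℝ
  /-- located letter `θC` -/
  θC : ℝ
  /-- located letter `KG` -/
  KG : ℝ
  /-- located letter `KΓ` -/
  KΓ : ℝ
  /-- located letter `KCs` -/
  KCs : ℝ
  /-- located letter `K₀` -/
  K₀ : ℝ
  /-- located letter `KE` -/
  KE : ℝ
  /-- located letter `KG'` -/
  KG' : ℝ
  /-- located letter `KCs'` -/
  KCs' : ℝ
  /-- located letter `θΓ'` -/
  θΓ' : ℝ
  /-- located letter `θC'` -/
  θC' : ℝ
  /-- located letter `θE'` -/
  θE' : ℝ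
  /-- located letter `a'` -/
  a' : ℝ
  /-- located letter `w'` -/
  w' : ℝ
  /-- located letter `cE` -/
  cE : ℝ
  /-- located letter `g` -/
  g : ℝ
  /-- located letter `Rb` (the box radius of the unscaled-field boxes at `s₀`: `χχᶜ = 1` on `⟨B′,B′⟩ < Rb²`) -/
  Rb : ℝ
  /-- located letter `κ` -/
  κ : ℝ
  /-- located letter `a₀` -/
  a₀ : ℝ
  /-- located letter `w₀` -/
  w₀ : ℝ
  /-- located letter `T` -/
  T : ℝ
  /-- located letter `α₀` -/
  α₀ : ℝ
  /-- located letter `r₁` -/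
  r₁ : ℝ
  /-- located letter `TP` -/
  TP : ℝ
  /-- located letter `ac` -/
  ac : ℝ
  /-- located letter `wc` -/
  wc : ℝ
  /-- located input `hpos` (see the module docstring) -/
  hpos : ∀ Y : TDom P.d (L * domCount P M (k + 1)), 0 < invTau c ((tsys P.d (L * domCount P M (k + 1))).dj Y)
  /-- located input `hhalf` (see the module docstring) -/
  hhalf : ∀ Y : TDom P.d (L * domCount P M (k + 1)), invTau c ((tsys P.d (L * domCount P M (k + 1))).dj Y) ≤ 1 / 2
  /-- located input `hUσ` (see the module docstring) -/
  hUσ : IsOpen Uσ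
  /-- located input `hUτ` (see the module docstring) -/
  hUτ : ∀ Y, IsOpen (Uτ Y)
  /-- located input `hUexp` (see the module docstring) -/
  hUexp : closedBall (0 : ℂ) (Real.exp c.κ₁) ⊆ Uσ
  /-- located input `hUtau` (see the module docstring) -/
  hUtau : ∀ Y : TDom P.d (L * domCount P M (k + 1)), closedBall (0 : ℂ) ((invTau c ((tsys P.d (L * domCount P M (k + 1))).dj Y))⁻¹) ⊆ Uτ Y
  /-- located input `hr` (see the module docstring) -/
  hr : 0 < 𝔇.r
  /-- located input `hr'` (see the module docstring) -/
  hr' : 𝔇.r ≤ Real.exp c.κ₁ - 1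
  /-- located input `hsubτ` (see the module docstring) -/
  hsubτ : ∀ Y, ∀ x ∈ Set.uIcc (0 : ℝ) 1, closedBall (x : ℂ) 𝔇.r ⊆ Uτ Y
  /-- located input `hχ0` (see the module docstring) -/
  hχ0 : ∀ B, 0 ≤ χu Z t (s₀ • B)
  /-- located input `hχc0` (see the module docstring) -/
  hχc0 : ∀ B, 0 ≤ χcu Z t (s₀ • B)
  /-- located input `hχm` (see the module docstring) -/
  hχm : Measurable fun B : ((𝔇.𝒦 Z t).Λ) → ℝ => χu Z t (s₀ • B)
  /-- located input `hχcm` (see the module docstring) -/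
  hχcm : Measurable fun B : ((𝔇.𝒦 Z t).Λ) → ℝ => χcu Z t (s₀ • B)
  /-- located input `h222` (see the module docstring) -/
  h222 : ∀ B, χu Z t (s₀ • B) * χcu Z t (s₀ • B) ≤ Real.exp (-(γ₂ / 2 * rP ^ 2 * (t.2.card : ℕ)) + γ₂ / 2 * qP B)
  /-- located input `hγ₂` (see the module docstring) -/
  hγ₂ : 0 ≤ γ₂
  /-- located input `hqP` (see the module docstring) -/
  hqP : ∀ B, qP B ≤ B ⬝ᵥ B
  /-- located input `hAhol` (see the module docstring) -/
  hAhol : ∀ i j, DifferentiableOn ℂ (fun σ => 𝔇.A Z t φ σ i j) {σ | ∀ j, σ j ∈ Uσ}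
  /-- located input `hGhol` (see the module docstring) -/
  hGhol : ∀ i j, DifferentiableOn ℂ (fun σ => (𝔇.𝒦 Z t).G2 σ (𝔇.uOf Z t φ) i j) {σ | ∀ j, σ j ∈ Uσ}
  /-- located input `hAs` (see the module docstring) -/
  hAs : ∀ σ : TPt P.d (domCount P M (k + 1)) → ℂ, (∀ j, σ j ∈ Uσ) → (𝔇.A Z t φ σ).IsSymm
  /-- located input `hfibN` (see the module docstring) -/
  hfibN : ∀ x : UT 𝔇.Nf, (Finset.univ.filter fun j => (𝔇.𝒦 Z t).locN j = x).card ≤ (𝔇.𝒦 Z t).m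
  /-- located input `hkap''` (see the module docstring) -/
  hkap'' : 0 < kap''
  /-- located input `hk1` (rate order) -/
  hk1 : kap'' < kap'
  /-- located input `hk2` (rate order) -/
  hk2 : kap' < kap
  /-- located input `hθE` (see the module docstring) -/
  hθE : 0 ≤ θE
  /-- located input `hθΓ` (see the module docstring) -/
  hθΓ : 0 ≤ θΓ
  /-- located input `hθC` (see the module docstring) -/
  hθC : 0 ≤ θC
  /-- located input `hKG` (see the module docstring) -/
  hKG : 0 ≤ KG
  /-- located input `hKΓ` (see the module docstring) -/
  hKΓ : 0 ≤ KΓ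
  /-- located input `hKCs` (see the module docstring) -/
  hKCs : 0 ≤ KCs
  /-- located input `hK₀` (see the module docstring) -/
  hK₀ : 0 ≤ K₀
  /-- located input `hKE` (see the module docstring) -/
  hKE : 0 ≤ KE
  /-- located input `hG` (see the module docstring) -/
  hG : ∀ σ : TPt P.d (domCount P M (k + 1)) → ℂ, (∀ j, σ j ∈ Uσ) → ∀ b j, ‖(𝔇.𝒦 Z t).G2 σ (𝔇.uOf Z t φ) b j‖ ≤ KG * Real.exp (-(kap * tdist1 𝔇.Nf ((𝔇.𝒦 Z t).locΛ b) ((𝔇.𝒦 Z t).locN j)))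
  /-- located input `hΓ₀` (see the module docstring) -/
  hΓ₀ : ∀ b j, ‖(𝔇.𝒦 Z t).Γ₀ b j‖ ≤ KΓ * Real.exp (-(kap * tdist1 𝔇.Nf ((𝔇.𝒦 Z t).locΛ b) ((𝔇.𝒦 Z t).locN j)))
  /-- located input `hCs` (see the module docstring) -/
  hCs : ∀ σ : TPt P.d (domCount P M (k + 1)) → ℂ, (∀ j, σ j ∈ Uσ) → ∀ b b', ‖(𝔇.A Z t φ σ)⁻¹ b b'‖ ≤ KCs * Real.exp (-(kap * tdist1 𝔇.Nf ((𝔇.𝒦 Z t).locΛ b) ((𝔇.𝒦 Z t).locΛ b')))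
  /-- located input `hC216` (see the module docstring) -/
  hC216 : ∀ b b', ‖(𝔇.𝒦 Z t).C b b'‖ ≤ K₀ * Real.exp (-(kap * tdist1 𝔇.Nf ((𝔇.𝒦 Z t).locΛ b) ((𝔇.𝒦 Z t).locΛ b')))
  /-- located input `hCE` (see the module docstring) -/
  hCE : ∀ b b', ‖((𝔇.𝒦 Z t).C⁻¹.map (algebraMap ℝ ℂ)) b b'‖ ≤ KE * Real.exp (-(kap * tdist1 𝔇.Nf ((𝔇.𝒦 Z t).locΛ b) ((𝔇.𝒦 Z t).locΛ b')))
  /-- located input `hdΓ` (see the module docstring) -/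
  hdΓ : ∀ σ : TPt P.d (domCount P M (k + 1)) → ℂ, (∀ j, σ j ∈ Uσ) → ∀ b j, ‖((𝔇.𝒦 Z t).G2 σ (𝔇.uOf Z t φ) - (𝔇.𝒦 Z t).Γ₀.map (algebraMap ℝ ℂ)) b j‖ ≤ θΓ * Real.exp (-(kap * tdist1 𝔇.Nf ((𝔇.𝒦 Z t).locΛ b) ((𝔇.𝒦 Z t).locN j)))
  /-- located input `hdC` (see the module docstring) -/
  hdC : ∀ σ : TPt P.d (domCount P M (k + 1)) → ℂ, (∀ j, σ j ∈ Uσ) → ∀ b b', ‖((𝔇.A Z t φ σ)⁻¹ - (𝔇.𝒦 Z t).C.map (algebraMap ℝ ℂ)) b b'‖ ≤ θC * Real.exp (-(kap * tdist1 𝔇.Nf ((𝔇.𝒦 Z t).locΛ b) ((𝔇.𝒦 Z t).locΛ b')))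
  /-- located input `hdE` (see the module docstring) -/
  hdE : ∀ σ : TPt P.d (domCount P M (k + 1)) → ℂ, (∀ j, σ j ∈ Uσ) → ∀ b b', ‖(𝔇.A Z t φ σ - (𝔇.𝒦 Z t).C⁻¹.map (algebraMap ℝ ℂ)) b b'‖ ≤ θE * Real.exp (-(kap * tdist1 𝔇.Nf ((𝔇.𝒦 Z t).locΛ b) ((𝔇.𝒦 Z t).locΛ b')))
  /-- located input `hKG'` (see the module docstring) -/
  hKG' : (1 + ρb) * KG ≤ KG'
  /-- located input `hKCs'` (see the module docstring) -/
  hKCs' : ((1 - ρb) ^ 2)⁻¹ * KCs ≤ KCs'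
  /-- located input `hθΓ'` (see the module docstring) -/
  hθΓ' : θΓ + ρb * KG ≤ θΓ'
  /-- located input `hθC'` (see the module docstring) -/
  hθC' : θC + ρb * (2 + ρb) * ((1 - ρb) ^ 2)⁻¹ * KCs ≤ θC'
  /-- located input `hθE'` (see the module docstring) -/
  hθE' : θE + ρb * (2 + ρb) * (θE + KE) ≤ θE'
  /-- located input `hθEle` (see the module docstring) -/
  hθEle : θE' ≤ θ
  /-- located input `hθΓle` (see the module docstring) -/
  hθΓle : θΓ' ≤ θ
  /-- located input `hθR1le` (see the module docstring) -/
  hθR1le : ((𝔇.𝒦 Z t).m * (1 + 2 / (kap - kap')) ^ 𝔇.ν) * ((𝔇.𝒦 Z t).m * (1 + 2 / (kap' - kap'')) ^ 𝔇.ν) * (θΓ' * KCs' * KG' + KΓ * θC' * KG' + KΓ * K₀ * θΓ') ≤ θ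
  /-- located input `hsmallKθ` (see the module docstring) -/
  hsmallKθ : K₀ * ((𝔇.𝒦 Z t).m * (1 + 2 / kap) ^ 𝔇.ν) * (θ * ((𝔇.𝒦 Z t).m * (1 + 2 / kap'') ^ 𝔇.ν)) < 1
  /-- located input `hc0` (see the module docstring) -/
  hc0 : 0 ≤ cE
  /-- located input `hc` (see the module docstring) -/
  hc : ∀ i, (𝔇.𝒦 Z t).hC.1.eigenvalues i ≤ cE
  /-- located input `hαc` (see the module docstring) -/
  hαc : (2 * (θ * ((𝔇.𝒦 Z t).m * (1 + 2 / kap'') ^ 𝔇.ν)) + (γ₂ + a')) * cE ≤ 1 / 2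
  /-- located input `hg` (see the module docstring) -/
  hg : 0 ≤ g
  /-- located input `hΓq` (see the module docstring) -/
  hΓq : ∀ X : (𝔇.𝒦 Z t).Λ ⊕ (𝔇.𝒦 Z t).C₀ → ℝ, ((𝔇.𝒦 Z t).Γ₀ *ᵥ X) ⬝ᵥ ((𝔇.𝒦 Z t).C *ᵥ ((𝔇.𝒦 Z t).Γ₀ *ᵥ X)) ≤ g * (X ⬝ᵥ X)
  /-- located input `hsmall` (see the module docstring) -/
  hsmall : (2 * (θ * ((𝔇.𝒦 Z t).m * (1 + 2 / kap'') ^ 𝔇.ν)) + (γ₂ + a')) * (1 + 2 * cE * g) ≤ 1 / 2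
  /-- located input `hPa` (see the module docstring) -/
  hPa : a ≤ γ₂ * rP ^ 2
  /-- located input `hvol` (see the module docstring) -/
  hvol : 2 * (K₀ * ((𝔇.𝒦 Z t).m * (1 + 2 / kap) ^ 𝔇.ν) * (θ * ((𝔇.𝒦 Z t).m * (1 + 2 / kap'') ^ 𝔇.ν)) * (1 + (1 - K₀ * ((𝔇.𝒦 Z t).m * (1 + 2 / kap) ^ 𝔇.ν) * (θ * ((𝔇.𝒦 Z t).m * (1 + 2 / kap'') ^ 𝔇.ν)))⁻¹) / 2) * (Fintype.card (𝔇.𝒦 Z t).Λ : ℝ) + w' + (2 * (θ * ((𝔇.𝒦 Z t).m * (1 + 2 / kap'') ^ 𝔇.ν)) + (γ₂ + a')) * cE * (Fintype.card (𝔇.𝒦 Z t).Λ : ℝ) + (2 * (θ * ((𝔇.𝒦 Z t).m * (1 + 2 / kap'') ^ 𝔇.ν)) + (γ₂ + a')) * (1 + 2 * cE * g) * (Fintype.card ((𝔇.𝒦 Z t).Λ ⊕ (𝔇.𝒦 Z t).C₀) : ℝ) ≤ a₅ * ((Z.1).card : ℝ)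
  /-- located input `hχe` (see the module docstring) -/
  hχe : ∀ B, χu Z t (s₀ • (-B)) = χu Z t (s₀ • B)
  /-- located input `hχce` (see the module docstring) -/
  hχce : ∀ B, χcu Z t (s₀ • (-B)) = χcu Z t (s₀ • B)
  /-- located input `hαc_c` (see the module docstring) -/
  hαc_c : (2 * (θ * ((𝔇.𝒦 Z t).m * (1 + 2 / kap'') ^ 𝔇.ν)) + (γ₂ + ac)) * cE ≤ 1 / 2
  /-- located input `hsmall_c` (see the module docstring) -/
  hsmall_c : (2 * (θ * ((𝔇.𝒦 Z t).m * (1 + 2 / kap'') ^ 𝔇.ν)) + (γ₂ + ac)) * (1 + 2 * cE * g) ≤ 1 / 2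
  /-- located input `hvol_c` (see the module docstring) -/
  hvol_c : 2 * (K₀ * ((𝔇.𝒦 Z t).m * (1 + 2 / kap) ^ 𝔇.ν) * (θ * ((𝔇.𝒦 Z t).m * (1 + 2 / kap'') ^ 𝔇.ν)) * (1 + (1 - K₀ * ((𝔇.𝒦 Z t).m * (1 + 2 / kap) ^ 𝔇.ν) * (θ * ((𝔇.𝒦 Z t).m * (1 + 2 / kap'') ^ 𝔇.ν)))⁻¹) / 2) * (Fintype.card (𝔇.𝒦 Z t).Λ : ℝ) + wc + (2 * (θ * ((𝔇.𝒦 Z t).m * (1 + 2 / kap'') ^ 𝔇.ν)) + (γ₂ + ac)) * cE * (Fintype.card (𝔇.𝒦 Z t).Λ : ℝ) + (2 * (θ * ((𝔇.𝒦 Z t).m * (1 + 2 / kap'') ^ 𝔇.ν)) + (γ₂ + ac)) * (1 + 2 * cE * g) * (Fintype.card ((𝔇.𝒦 Z t).Λ ⊕ (𝔇.𝒦 Z t).C₀) : ℝ) ≤ a₅ * ((Z.1).card : ℝ)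
  /-- located input `hχ1` (see the module docstring) — SMALL-FIELD block: asked only on `P(t) = ∅` (№193; the box law is a small-field statement) -/
  hχ1 : t.2 = ∅ → ∀ B, χu Z t (s₀ • B) * χcu Z t (s₀ • B) ≤ 1
  /-- located input `hκ` (see the module docstring) -/
  hκ : 0 ≤ κ
  /-- located input `hboxR`: the BOX LAW of the unscaled-field boxes at `s₀` on `⟨B′,B′⟩ < Rb²` — SMALL-FIELD block: asked only on `P(t) = ∅` (№193; the box law is a small-field statement) -/
  hboxR : t.2 = ∅ → ∀ B, B ⬝ᵥ B < Rb ^ 2 → χu Z t (s₀ • B) * χcu Z t (s₀ • B) = 1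
  /-- located input `ha₀` (see the module docstring) -/
  ha₀ : 0 ≤ a₀
  /-- located input `hαc_b` (see the module docstring) -/
  hαc_b : (2 * (θ * ((𝔇.𝒦 Z t).m * (1 + 2 / kap'') ^ 𝔇.ν)) + (κ + a₀)) * cE ≤ 1 / 2
  /-- located input `hsmall_b` (see the module docstring) -/
  hsmall_b : (2 * (θ * ((𝔇.𝒦 Z t).m * (1 + 2 / kap'') ^ 𝔇.ν)) + (κ + a₀)) * (1 + 2 * cE * g) ≤ 1 / 2
  /-- located input `hvol_b` (see the module docstring) -/
  hvol_b : 2 * (K₀ * ((𝔇.𝒦 Z t).m * (1 + 2 / kap) ^ 𝔇.ν) * (θ * ((𝔇.𝒦 Z t).m * (1 + 2 / kap'') ^ 𝔇.ν)) * (1 + (1 - K₀ * ((𝔇.𝒦 Z t).m * (1 + 2 / kap) ^ 𝔇.ν) * (θ * ((𝔇.𝒦 Z t).m * (1 + 2 / kap'') ^ 𝔇.ν)))⁻¹) / 2) * (Fintype.card (𝔇.𝒦 Z t).Λ : ℝ) + w₀ + (2 * (θ * ((𝔇.𝒦 Z t).m * (1 + 2 / kap'') ^ 𝔇.ν)) +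 (κ + a₀)) * cE * (Fintype.card (𝔇.𝒦 Z t).Λ : ℝ) + (2 * (θ * ((𝔇.𝒦 Z t).m * (1 + 2 / kap'') ^ 𝔇.ν)) + (κ + a₀)) * (1 + 2 * cE * g) * (Fintype.card ((𝔇.𝒦 Z t).Λ ⊕ (𝔇.𝒦 Z t).C₀) : ℝ) ≤ a₅ * ((Z.1).card : ℝ)
  /-- located input `hα₀` (see the module docstring) -/
  hα₀ : 0 ≤ α₀
  /-- located input `hαc_f` (see the module docstring) -/
  hαc_f : (2 * (θ * ((𝔇.𝒦 Z t).m * (1 + 2 / kap'') ^ 𝔇.ν)) + α₀) * cE ≤ 1 / 2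
  /-- located input `hsmall_f` (see the module docstring) -/
  hsmall_f : (2 * (θ * ((𝔇.𝒦 Z t).m * (1 + 2 / kap'') ^ 𝔇.ν)) + α₀) * (1 + 2 * cE * g) ≤ 1 / 2
  /-- located input `hr₁` (see the module docstring) — LARGE-FIELD block: asked only on `P(t) ≠ ∅` (№193; the (2.22) surplus at radius `r_P` over `r₁`) -/
  hr₁ : t.2 ≠ ∅ → r₁ ^ 2 ≤ rP ^ 2
  /-- located input `hPa1` (see the module docstring) — LARGE-FIELD block: asked only on `P(t) ≠ ∅` (№193; the (2.22) surplus at radius `r_P` over `r₁`) -/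
  hPa1 : t.2 ≠ ∅ → a ≤ γ₂ * r₁ ^ 2
  /-- located input `hA` (see the module docstring) -/
  hA : ∀ σ : TPt P.d (domCount P M (k + 1)) → ℂ, (∀ j, σ j ∈ Uσ) → ((𝔇.A Z t φ σ).map Complex.re).PosDef
  /-- located input `hθEle0` (see the module docstring) -/
  hθEle0 : θE ≤ θ
  /-- located input `hθΓle0` (see the module docstring) -/
  hθΓle0 : θΓ ≤ θ
  /-- located input `hθR1le0` (see the module docstring) -/
  hθR1le0 : ((𝔇.𝒦 Z t).m * (1 + 2 / (kap - kap')) ^ 𝔇.ν) * ((𝔇.𝒦 Z t).m * (1 + 2 / (kap' - kap'')) ^ 𝔇.ν) * (θΓ * KCs * KG + KΓ * θC * KG + KΓ * K₀ * θΓ) ≤ θ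
  /-- located input `hαc_0` (see the module docstring) -/
  hαc_0 : (2 * (θ * ((𝔇.𝒦 Z t).m * (1 + 2 / kap'') ^ 𝔇.ν)) + (γ₂ + a₀)) * cE ≤ 1 / 2
  /-- located input `hsmall_0` (see the module docstring) -/
  hsmall_0 : (2 * (θ * ((𝔇.𝒦 Z t).m * (1 + 2 / kap'') ^ 𝔇.ν)) + (γ₂ + a₀)) * (1 + 2 * cE * g) ≤ 1 / 2
  /-- located input `hvol_0` (see the module docstring) -/
  hvol_0 : 2 * (K₀ * ((𝔇.𝒦 Z t).m * (1 + 2 / kap) ^ 𝔇.ν) * (θ * ((𝔇.𝒦 Z t).m * (1 + 2 / kap'') ^ 𝔇.ν)) * (1 + (1 - K₀ * ((𝔇.𝒦 Z t).m * (1 + 2 / kap) ^ 𝔇.ν) * (θ * ((𝔇.𝒦 Z t).m * (1 + 2 / kap'') ^ 𝔇.ν)))⁻¹) / 2) * (Fintype.card (𝔇.𝒦 Z t).Λ : ℝ) + w₀ + (2 * (θ * ((𝔇.𝒦 Z t).m * (1 + 2 / kap'') ^ 𝔇.ν)) + (γ₂ + a₀)) * cE * (Fintype.card (𝔇.𝒦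 Z t).Λ : ℝ) + (2 * (θ * ((𝔇.𝒦 Z t).m * (1 + 2 / kap'') ^ 𝔇.ν)) + (γ₂ + a₀)) * (1 + 2 * cE * g) * (Fintype.card ((𝔇.𝒦 Z t).Λ ⊕ (𝔇.𝒦 Z t).C₀) : ℝ) ≤ a₅ * ((Z.1).card : ℝ)
  /-- located input `hRb`: the box-tail rate `e^{−½κRb²} ≤ T·s₀²` — SMALL-FIELD block: asked only on `P(t) = ∅` (№193; the box law is a small-field statement) -/
  hRb : t.2 = ∅ → Real.exp (-(κ / 2 * Rb ^ 2)) ≤ T * s₀ ^ 2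
  /-- located input `hTP` (see the module docstring) — LARGE-FIELD block: asked only on `P(t) ≠ ∅` (№193; the (2.22) surplus at radius `r_P` over `r₁`) -/
  hTP : t.2 ≠ ∅ → Real.exp (-(γ₂ / 2 * (rP ^ 2 - r₁ ^ 2))) ≤ TP * s₀ ^ 2
  /-- located input `hMvT` (see the module docstring) — SMALL-FIELD block: asked only on `P(t) = ∅` (№193; the box law is a small-field statement) -/
  hMvT : t.2 = ∅ → 1 + T ≤ Mv
  /-- located input `hMvP` (see the module docstring) — LARGE-FIELD block: asked only on `P(t) ≠ ∅` (№193; the (2.22) surplus at radius `r_P` over `r₁`) -/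
  hMvP : t.2 ≠ ∅ → TP ≤ Mv
  -- ═════════ THE LOCAL GROWTH BLOCK (node00-def-W1 W1-12 `TermDatum214.LocalGrowthInputs` vocabulary; slice-level letters, the OLDER-TERM letters for EVERY ADMISSIBLE
  -- history `old ∈ W1.AdmHist (W1.spaceOfRecord Sg Rz α₀ α₁) E₀ κE k` = (1.18)`(E₀, κE)` on the space tables of record ∧ analytic there, [I] p. 263; lens T32 ∕ (R-a)) ═════════
  /-- located letter `𝒲₃`: the CUBIC part of the Wilson remainder `𝒲(φ; Y, ·)` (Lemma 2's leading part) -/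
  𝒲₃ : TDom P.d (L * domCount P M (k + 1)) → ((𝔇.𝒦 Z t).Λ → ℝ) → ℂ
  /-- located letter `D𝒪`: the LINEAR part at the zero field of the older-terms potential `𝒪(old, φ; Y, ·)`, per history -/
  D𝒪 : OlderTerms P 𝔸 M k → TDom P.d (L * domCount P M (k + 1)) → ((𝔇.𝒦 Z t).Λ → ℝ) → ℂ
  /-- located letter `ρ`: the radius of the sup-ball of the unscaled field ([II] (1.34), print's ε₁; coupling-free) -/
  ρ : ℝ
  /-- located input `hρ` -/
  hρ : 0 < ρ
  /-- located input `h𝒲m`: measurability of the Wilson remainder in the unscaled row-bond field -/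
  h𝒲m : ∀ Y : TDom P.d (L * domCount P M (k + 1)), Measurable (𝒲 Z t φ Y)
  /-- located input `h𝒲₃m` -/
  h𝒲₃m : ∀ Y : TDom P.d (L * domCount P M (k + 1)), Measurable (𝒲₃ Y)
  /-- located input `h𝒲₃`: cubic homogeneity of `𝒲₃` under real dilations -/
  h𝒲₃ : ∀ (Y : TDom P.d (L * domCount P M (k + 1))) (r : ℝ) (A : ((𝔇.𝒦 Z t).Λ → ℝ)), 𝒲₃ Y (r • A) = (r : ℂ) ^ 3 * 𝒲₃ Y A
  /-- located letter `R`: the τ-radii bounds of the per-domain regions `Uτ Y` -/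
  R : TDom P.d (L * domCount P M (k + 1)) → ℝ
  /-- located letter `c₀` ((L0)) -/
  c₀ : TDom P.d (L * domCount P M (k + 1)) → ℝ
  /-- located letter `c₃` ((L1)∕(ℓ1)) -/
  c₃ : TDom P.d (L * domCount P M (k + 1)) → ℝ
  /-- located letter `c₃'` ((L3)) -/
  c₃' : TDom P.d (L * domCount P M (k + 1)) → ℝ
  /-- located letter `c₄` ((L2)) -/
  c₄ : TDom P.d (L * domCount P M (k + 1)) → ℝ
  /-- located letter `c₁` ((L4)) -/
  c₁ : TDom P.d (L * domCount P M (k + 1)) → ℝ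
  /-- located letter `c₁'` ((L6)) -/
  c₁' : TDom P.d (L * domCount P M (k + 1)) → ℝ
  /-- located letter `c₂` ((L5)) -/
  c₂ : TDom P.d (L * domCount P M (k + 1)) → ℝ
  /-- located input `hR` -/
  hR : ∀ Y ∈ t.1, 0 ≤ R Y
  /-- located input `hc₃` -/
  hc₃ : ∀ Y ∈ t.1, 0 ≤ c₃ Y
  /-- located input `hc₃'` -/
  hc₃' : ∀ Y ∈ t.1, 0 ≤ c₃' Y
  /-- located input `hc₄` -/
  hc₄ : ∀ Y ∈ t.1, 0 ≤ c₄ Y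
  /-- located input `hc₁` -/
  hc₁ : ∀ Y ∈ t.1, 0 ≤ c₁ Y
  /-- located input `hc₁'` -/
  hc₁' : ∀ Y ∈ t.1, 0 ≤ c₁' Y
  /-- located input `hc₂` -/
  hc₂ : ∀ Y ∈ t.1, 0 ≤ c₂ Y
  /-- located input `hUτR`: the τ-regions lie in the discs of radii `R Y` -/
  hUτR : ∀ Y ∈ t.1, ∀ z ∈ Uτ Y, ‖z‖ ≤ R Y
  /-- located input `h1`: the LOCAL cubic letter (L1) of the Wilson remainder on the sup-ball -/
  h1 : ∀ Y ∈ t.1, ∀ A : ((𝔇.𝒦 Z t).Λ → ℝ), ‖A‖ ≤ ρ → ‖𝒲 Z t φ Y A‖ ≤ c₃ Y * ‖A‖ ^ 3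
  /-- located letter `S`: the bond supports of the Wilson remainder per domain -/
  S : TDom P.d (L * domCount P M (k + 1)) → Finset (𝔇.𝒦 Z t).Λ
  /-- located input `h1loc`: the `Y`-LOCALISED cubic letter (ℓ1) -/
  h1loc : ∀ Y ∈ t.1, ∀ A : ((𝔇.𝒦 Z t).Λ → ℝ), ‖A‖ ≤ ρ → ‖𝒲 Z t φ Y A‖ ≤ c₃ Y * ‖A‖ * ∑ b ∈ S Y, A b ^ 2
  /-- located letter `cubeOf`: the cube-location of the row bonds ((G)) -/
  cubeOf : (𝔇.𝒦 Z t).Λ → TPt P.d (L * domCount P M (k + 1))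
  /-- located input `hS`: the supports `S Y` lie in `Y` -/
  hS : ∀ Y ∈ t.1, ∀ b ∈ S Y, cubeOf b ∈ Y.1
  /-- located letter `Cp`: the (2.19) profile constant of the rate weight `R(Y)c₃(Y)` -/
  Cp : ℝ
  /-- located letter `κp`: the (2.19) profile rate -/
  κp : ℝ
  /-- located input `hCp` -/
  hCp : 0 ≤ Cp
  /-- located input `hκp`: the profile rate is above the (1.26) threshold -/
  hκp : kappa₀ (4 * 2 ^ P.d) (2 * P.d) ≤ κp
  /-- located input `hdecay`: the (2.19) PROFILE of the rate weight ((P)) -/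
  hdecay : ∀ Y ∈ t.1, R Y * c₃ Y ≤ Cp * Real.exp (-κp * (tsys P.d (L * domCount P M (k + 1))).dj Y)
  /-- located input `h2`: the LOCAL letter (L2) (the Wilson remainder minus its cubic part) -/
  h2 : ∀ Y ∈ t.1, ∀ A : ((𝔇.𝒦 Z t).Λ → ℝ), ‖A‖ ≤ ρ → ‖𝒲 Z t φ Y A - 𝒲₃ Y A‖ ≤ c₄ Y * ‖A‖ ^ 4
  /-- located input `h3`: the global letter (L3) of the cubic part -/
  h3 : ∀ Y ∈ t.1, ∀ A : ((𝔇.𝒦 Z t).Λ → ℝ), ‖𝒲₃ Y A‖ ≤ c₃' Y * ‖A‖ ^ 3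
  /-- located letter `S₀`: the box-support coordinate set ((2.2)–(2.3), [I] (2.9)) -/
  S₀ : Set (𝔇.𝒦 Z t).Λ
  /-- located input `hbox`: the s-FREE BOX-SUPPORT LAW of `χᵘ` on the unscaled field -/
  hbox : ∀ A : ((𝔇.𝒦 Z t).Λ → ℝ), χu Z t A ≠ 0 → ∀ b ∈ S₀, |A b| ≤ ρ
  /-- located input `hloc𝒲`: the `Y`-locality of the Wilson remainder in `S₀` -/
  hloc𝒲 : ∀ Y ∈ t.1, ∀ A A' : ((𝔇.𝒦 Z t).Λ → ℝ), (∀ b ∈ S₀, A b = A' b) → 𝒲 Z t φ Y A = 𝒲 Z t φ Y A'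
  /-- located letter `δ`: the centred rate split -/
  δ : ℝ
  /-- located input `hδ` -/
  hδ : 0 < δ
  /-- located input `h𝒪m`: measurability of the older-terms potential, EVERY ADMISSIBLE history -/
  h𝒪m : ∀ old : OlderTerms P 𝔸 M k, old ∈ AdmHist (spaceOfRecord (M := M) Sg Rz (fun _ => cs.α₀) (fun _ => cs.α₁)) E₀ κE k → ∀ Y : TDom P.d (L * domCount P M (k + 1)), Measurable (𝒪 Z t old φ Y)
  /-- located input `hD𝒪m` -/
  hD𝒪m : ∀ old : OlderTerms P 𝔸 M k, old ∈ AdmHist (spaceOfRecord (M := M) Sg Rz (fun _ => cs.α₀) (fun _ => cs.α₁)) E₀ κE k → ∀ Y : TDom P.d (L * domCount P M (k + 1)), Measurable (D𝒪 old Y)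
  /-- located input `hD𝒪`: linear homogeneity of `D𝒪` under real dilations -/
  hD𝒪 : ∀ old : OlderTerms P 𝔸 M k, old ∈ AdmHist (spaceOfRecord (M := M) Sg Rz (fun _ => cs.α₀) (fun _ => cs.α₁)) E₀ κE k → ∀ (Y : TDom P.d (L * domCount P M (k + 1))) (r : ℝ) (A : ((𝔇.𝒦 Z t).Λ → ℝ)), D𝒪 old Y (r • A) = (r : ℂ) * D𝒪 old Y A
  /-- located input `h0`: the LOCAL letter (L0) `‖𝒪(old, φ; Y, 0)‖ ≤ c₀(Y)`, every admissible history -/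
  h0 : ∀ old : OlderTerms P 𝔸 M k, old ∈ AdmHist (spaceOfRecord (M := M) Sg Rz (fun _ => cs.α₀) (fun _ => cs.α₁)) E₀ κE k → ∀ Y ∈ t.1, ‖𝒪 Z t old φ Y 0‖ ≤ c₀ Y
  /-- located input `h4`: the LOCAL Lipschitz letter (L4) of the older-terms potential on the sup-ball, every admissible history -/
  h4 : ∀ old : OlderTerms P 𝔸 M k, old ∈ AdmHist (spaceOfRecord (M := M) Sg Rz (fun _ => cs.α₀) (fun _ => cs.α₁)) E₀ κE k → ∀ Y ∈ t.1, ∀ A : ((𝔇.𝒦 Z t).Λ → ℝ), ‖A‖ ≤ ρ → ‖𝒪 Z t old φ Y A - 𝒪 Z t old φ Y 0‖ ≤ c₁ Y * ‖A‖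
  /-- located input `h5`: the LOCAL second-order letter (L5), every admissible history -/
  h5 : ∀ old : OlderTerms P 𝔸 M k, old ∈ AdmHist (spaceOfRecord (M := M) Sg Rz (fun _ => cs.α₀) (fun _ => cs.α₁)) E₀ κE k → ∀ Y ∈ t.1, ∀ A : ((𝔇.𝒦 Z t).Λ → ℝ), ‖A‖ ≤ ρ →
    ‖𝒪 Z t old φ Y A - 𝒪 Z t old φ Y 0 - D𝒪 old Y A‖ ≤ c₂ Y * ‖A‖ ^ 2
  /-- located input `h6`: the global letter (L6) of the linear part, every admissible history -/
  h6 : ∀ old : OlderTerms P 𝔸 M k, old ∈ AdmHist (spaceOfRecord (M := M) Sg Rz (fun _ => cs.α₀) (fun _ => cs.α₁)) E₀ κE k → ∀ Y ∈ t.1, ∀ A : ((𝔇.𝒦 Z t).Λ → ℝ), ‖D𝒪 old Y A‖ ≤ c₁' Y * ‖A‖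
  /-- located input `hloc𝒪`: the `Y`-locality of the older-terms potential in `S₀`, every admissible history -/
  hloc𝒪 : ∀ old : OlderTerms P 𝔸 M k, old ∈ AdmHist (spaceOfRecord (M := M) Sg Rz (fun _ => cs.α₀) (fun _ => cs.α₁)) E₀ κE k → ∀ Y ∈ t.1, ∀ A A' : ((𝔇.𝒦 Z t).Λ → ℝ), (∀ b ∈ S₀, A b = A' b) → 𝒪 Z t old φ Y A = 𝒪 Z t old φ Y A'
  /-- located input `hOhol`: holomorphy of the older-terms potential along every holomorphic (1.18)-bounded older-term curve whose values are ANALYTIC ON THE TABLES (the history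
  direction of Lemma 2's potentials — a producer's law, displayed) -/
  hOhol : ∀ (O : Set ℂ), IsOpen O → ∀ cv : ℂ → OlderTerms P 𝔸 M k,
    (∀ (j : Fin (k + 1)) (Y : (domSys P M j).Dom) (ψ : CPair P 𝔸), ψ ∈ spaceI Sg Rz M j (domSites P M j Y) cs.α₀ cs.α₁ →
      DifferentiableOn ℂ (fun z => cv z j Y ψ) O ∧ ∀ z ∈ O, ‖cv z j Y ψ‖ ≤ E₀ * Real.exp (-(κE * torusTreeLen Y.1))) →
    (∀ z ∈ O, ∀ (j : Fin (k + 1)) (Y : (domSys P M j).Dom), AnalyticOnNhd ℂ (cv z j Y) (spaceI Sg Rz M j (domSites P M j Y) cs.α₀ cs.α₁)) →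
    ∀ (Y : TDom P.d (L * domCount P M (k + 1))) (A : ((𝔇.𝒦 Z t).Λ → ℝ)), DifferentiableOn ℂ (fun z => 𝒪 Z t (cv z) φ Y A) O
  -- ═════════ THE CLOSURES (slice letters `a′ w′ a_c w_c w₀` against the local growth constants; `m₃ := C_p·K₀(4·2^d, 2d)` spelled out, `B12TreeDecay.K₀` qualified against the kernel letter `K₀` of this record) ═════════
  /-- located input `ha'`: the uncentred quadratic rate `(1+ρ_b)²·(2ρm₃) ≤ a′` -/
  ha' : (1 + ρb) ^ 2 * (2 * ρ * (Cp * B12TreeDecay.K₀ (4 * 2 ^ P.d) (2 * P.d))) ≤ a'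
  /-- located input `hw'`: the uncentred additive constant `(1+ρ_b)²·Σ R(c₀ + c₁ρ) ≤ w′` -/
  hw' : (1 + ρb) ^ 2 * (∑ Y ∈ t.1, R Y * (c₀ Y + c₁ Y * ρ)) ≤ w'
  /-- located input `hac`: the centred quadratic rate `2δ + 8ρm₃ ≤ a_c` -/
  hac : 2 * δ + 8 * ρ * (Cp * B12TreeDecay.K₀ (4 * 2 ^ P.d) (2 * P.d)) ≤ ac
  /-- located input `hwc`: the centred additive constant (dag-n10-c module 46 §4∕§5's closure inequality, verbatim shape) -/
  hwc : Real.exp (∑ Y ∈ t.1, R Y * c₀ Y) * ((∑ Y ∈ t.1, R Y * ((4 * c₄ Y + (4 * c₃ Y + 4 * c₃' Y) / ρ) * (4 / (Real.exp 1 * δ)) ^ 4 +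
      (c₂ Y + (c₁ Y + c₁' Y) / ρ) * (2 / (Real.exp 1 * δ)) ^ 2)) * Real.exp (δ / 2) +
      ((∑ Y ∈ t.1, R Y * (4 * c₃ Y * (3 / (Real.exp 1 * δ)) ^ 3 + c₁ Y * (1 / (Real.exp 1 * δ)))) * Real.exp (δ / 2)) ^ 2 *
      Real.exp ((∑ Y ∈ t.1, R Y * (c₀ Y + c₁ Y * ρ)) + ∑ Y ∈ t.1, R Y * c₀ Y)) ≤ Real.exp wc
  /-- located input `hw₀`: the centre's additive constant `Σ R(Y)c₀(Y) ≤ w₀` (the box tail's and the box-free centre's `Σ|τ||𝒪(·,0)| ≤ w₀`) -/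
  hw₀ : ∑ Y ∈ t.1, R Y * c₀ Y ≤ w₀
  -- ═════════ THE φ-ANALYTICITY INPUTS OF THE ADMISSIBLE-HISTORY EDITION ([II] (2.14) p. 15 «analytic function of (U, J)»; dag-n18-c's (T-an) at the member) ═════════
  /-- located input `hMan`: at every admissible history, every window-dilated member of base point `s₀` is analytic in the configuration at `φ` -/
  hMan : ∀ old : OlderTerms P 𝔸 M k, old ∈ AdmHist (spaceOfRecord (M := M) Sg Rz (fun _ => cs.α₀) (fun _ => cs.α₁)) E₀ κE k → ∀ b ∈ ball (1 : ℂ) ρb,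
    AnalyticAt ℂ (fun ψ : CPair P 𝔸 => term214 𝔇.r (sigmaList L Z t) (tauList P M k L t)
          (core214 (fun σ => b ^ 2 • 𝔇.A Z t ψ σ) (fun σ X => b • 𝔇.Gam Z t ψ σ X)
            (F214 t.2.card (fun B => χu Z t (s₀ • B)) (fun B => χcu Z t (s₀ • B)) t.1
              (fun Y B => b ^ 2 * ((((s₀ : ℝ) : ℂ) ^ 2)⁻¹ * 𝒲 Z t ψ Y (s₀ • B)) + 𝒪 Z t old ψ Y (s₀ • B)))) 0 0) φ
  /-- located input `hVan`: at every admissible history, the coupling-blind CENTRE term (no large-field boxes) is analytic in the configuration at `φ` -/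
  hVan : ∀ old : OlderTerms P 𝔸 M k, old ∈ AdmHist (spaceOfRecord (M := M) Sg Rz (fun _ => cs.α₀) (fun _ => cs.α₁)) E₀ κE k → t.2 = ∅ →
    AnalyticAt ℂ (fun ψ : CPair P 𝔸 => term214 𝔇.r (sigmaList L Z t) (tauList P M k L t)
          (core214 (𝔇.A Z t ψ) (𝔇.Gam Z t ψ) (F214 t.2.card (fun _ => (1 : ℝ)) (fun _ => (1 : ℝ)) t.1 (fun Y _ => 𝒪 Z t old ψ Y 0))) 0 0) φ

end YMDAG.N22.W1

end
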